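import Literature.MathematicalPhysics.QuantumLattice.HubbardBandBottomTwoParticleGap
import Literature.MathematicalPhysics.QuantumLattice.HubbardParityTwistedTrace
import Literature.Probability.LatticeModels.BackboneCurrent
import HarnessLib

/-!
# The parity-twisted partition function of the repulsive Hubbard model is negative at the band bottom

Topic `Literature/MathematicalPhysics/QuantumLattice` (sub-namespace `HubbardBandBottom`). Written for
route `HubbardSuperconductivity/ParityLeeYang`, support `BandBottomOnAxis` (stmt-HubbardSuperconductivity-8386);
the torus corollary closing that item lives in `Summits/…/Theorems/ParityLeeYangBandBottomOnAxis.lean`.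

**Theorem** (`parityTrace_neg_of_connected`). On any finite connected graph, for the repulsive
Hubbard model `H = hamiltonian G 1 U`, `U > 0`, there is `β₁` such that for all `β ≥ β₁` some
chemical potential `μ` has `Re Tr[parityOp · e^{-β(H - μN)}] < 0`.

Proof. Let `E₁` be the (simple, by Perron–Frobenius) lowest eigenvalue of minus the adjacency
matrix, `γ > 0` its gap and `E₂ > 2E₁` the two-particle ground energy (part 4). With
`δ = min(E₂ - 2E₁, γ/2)` every `N`-particle vector has `Re ⟨φ, H φ⟩ ≥ (N E₁ + δ(N-1)) ‖φ‖²`, so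
`H + diag(-(N E₁ + δ(N-1)))` is a nonnegative form and the diagonal Gibbs entries obey
`Re (e^{-βH})_{ss} ≤ e^{-β(|s| E₁ + δ(|s|-1))}` (part 5). In the sector sum
`Re Z_P = Σ_s (-1)^{|s|} e^{βμ|s|} Re (e^{-βH})_{ss}` at `μ = E₁ + δ/2` the vacuum contributes `1`,
the one-particle sector at most `-e^{βδ/2}` (the bottom one-particle state is an exact eigenvector),
and every other configuration at most `e^{βδ(1 - |s|/2)} ≤ 1`; hence `Re Z_P ≤ 4^{|Λ|} - e^{βδ/2} < 0`
for `β ≥ (2/δ) log(4^{|Λ|} + 1)`.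

* `fermionTorus_reflTransGen` — the fermionic torus is connected (input of the torus corollary).

No definitions. Sources: Tasaki–Watanabe 2021 / the route card (parity-twisted `Z` as a sign
datum); Lieb–Wu 2003 §2 (Perron–Frobenius); Bratteli–Robinson II §5.3.1.
-/

namespace Literature.MathematicalPhysics.QuantumLattice.HubbardBandBottom

open Matrix Finset Literature.MathematicalPhysics.QuantumLattice
  Literature.MathematicalPhysics.QuantumLattice.RayleighBound NormedSpace
open scoped ComplexOrder MatrixOrder

section Connected

variable {Λ : Type*} [LinearOrder Λ] [Fintype Λ] (G : SimpleGraph Λ) [DecidableRel G.Adj]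

/-- The Hubbard Hamiltonian commutes with any diagonal function of the particle number. [folklore] -/
theorem commute_hamiltonian_diagonal_card (t U : ℝ) (f : ℕ → ℂ) :
    Commute (hamiltonian G t U) (diagonal fun s : Finset (Orb Λ) => f s.card) := by
  rw [Commute, SemiconjBy]
  ext s s'
  rw [mul_diagonal, diagonal_mul]
  by_cases h : s.card = s'.card
  · rw [h, mul_comm]
  · rw [hamiltonian_apply_eq_zero_of_card_ne G t U s s' h, mul_zero, zero_mul]

/-- **Band-bottom negativity of the parity-twisted partition function on a connected graph.**
For `U > 0` there is `β₁` such that for every `β ≥ β₁` some `μ` makes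
`Re Tr[parityOp · e^{-β (H - μ N)}] < 0`, `H = hamiltonian G 1 U`. [folklore] -/
theorem parityTrace_neg_of_connected [Nonempty Λ]
    (hconn : ∀ x y : Λ, Relation.ReflTransGen G.Adj x y) {U : ℝ} (hU : 0 < U) :
    ∃ β₁ : ℝ, ∀ β : ℝ, β₁ ≤ β → ∃ μ : ℝ,
      (parityOp * Matrix.gibbsWeight β (hamiltonianWith G 1 U μ)).trace.re < 0 := by
  classical
  -- the site matrix and its Perron–Frobenius data
  set A : Matrix Λ Λ ℂ := Matrix.of fun x y : Λ => if G.Adj x y then (-1 : ℂ) else 0 with hAdef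
  have hA : A.IsHermitian := isHermitian_negAdj G
  have hhA : ∀ x σ y τ, hubbardOneBody G 1 0 (orb x σ) (orb y τ) = if σ = τ then A x y else 0 :=
    hubbardOneBody_orb_orb G
  have hsymm : ∀ i j, A i j = A j i := fun i j => by
    simp only [hAdef, Matrix.of_apply, G.adj_comm i j]
  have hreal : ∀ i j, star (A i j) = A i j := fun i j => by
    simp only [hAdef, Matrix.of_apply]; split_ifs <;> simp
  have hoff : ∀ i j, i ≠ j → (A i j).re ≤ 0 := fun i j _ => by
    simp only [hAdef, Matrix.of_apply]; split_ifs <;> simp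
  have hAadj : ∀ a b, G.Adj a b → A a b ≠ 0 := fun a b hab => by
    rw [hAdef, Matrix.of_apply, if_pos hab]; norm_num
  have hconn' : ∀ i j, Relation.ReflTransGen (fun a b => A a b ≠ 0) i j := fun i j =>
    Relation.ReflTransGen.mono (fun a b hab => hAadj a b hab) i j (hconn i j)
  set E₁ : ℝ := A.groundEnergy with hE₁
  obtain ⟨b, hb⟩ := Finset.card_eq_one.1
    (card_filter_eigenvalues_eq_groundEnergy hA hsymm hreal hoff hconn')
  have hb_iff : ∀ k, hA.eigenvalues k = E₁ ↔ k = b := fun k => by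
    have h := Finset.ext_iff.1 hb k
    simpa [Finset.mem_filter] using h
  have hbE : hA.eigenvalues b = E₁ := (hb_iff b).2 rfl
  obtain ⟨γ, hγ0, hγ⟩ := exists_gap hA
  have hγ' : ∀ k, k ≠ b → E₁ + γ ≤ hA.eigenvalues k := fun k hk =>
    hγ k fun h => hk ((hb_iff k).1 h)
  have hE : ∀ k, E₁ ≤ hA.eigenvalues k := fun k => groundEnergy_le_eigenvalues hA k
  -- the two-particle gap and the uniform rate `δ`
  have hcard : 1 ≤ Fintype.card Λ := Fintype.card_pos
  have hgap := two_particle_gap G hA hhA (fun k h => (hb_iff k).1 h) hU hcard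
  set δ : ℝ := min (groundEnergyAt G 1 U 2 - 2 * E₁) (γ / 2) with hδ
  have hδ0 : 0 < δ := lt_min (by linarith) (by linarith)
  have hδg : δ ≤ groundEnergyAt G 1 U 2 - 2 * E₁ := min_le_left _ _
  have hδγ : δ ≤ γ / 2 := min_le_right _ _
  -- sector lower bounds `m(N) = N E₁ + δ (N - 1)`
  set H : Matrix (Finset (Orb Λ)) (Finset (Orb Λ)) ℂ := hamiltonian G 1 U with hHdef
  set m : ℕ → ℝ := fun N => N * E₁ + δ * ((N : ℝ) - 1) with hm
  have hsec : ∀ (N : ℕ) (φ : Fock (Orb Λ)), IsNParticle N φ →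
      m N * normSq φ ≤ (star φ ⬝ᵥ (H *ᵥ φ)).re := by
    intro N φ hφ
    have hn0 := normSq_nonneg φ
    rcases Nat.lt_or_ge N 3 with hN | hN
    · interval_cases N
      · -- vacuum sector: `H φ = 0`
        have hvac := isNParticle_zero_eq_smul_vacuum hφ
        have h0 : H *ᵥ φ = 0 := by
          rw [hvac, mulVec_smul, hHdef, hamiltonian_mulVec_vacuum, smul_zero]
        rw [h0, dotProduct_zero, Complex.zero_re, hm]
        simp only [Nat.cast_zero, zero_mul, zero_sub, zero_add]
        nlinarith
      · have h := sector_lower_bound G hA hhA (fun k h => (hb_iff k).1 h) le_rfl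
          (fun k _ => by rw [add_zero]; exact hE k) hU.le hφ
        rw [hm]; simp only [Nat.cast_one, one_mul, sub_self, mul_zero, add_zero] at h ⊢
        simpa using h
      · have h := ThermodynamicLimit.groundEnergyAt_mul_norm_le G 1 U hφ
        rw [star_dotProduct_self_eq_normSq, Complex.ofReal_re,
          Literature.MathematicalPhysics.QuantumLattice.expect] at h
        rw [hm]
        have : ((2 : ℕ) : ℝ) * E₁ + δ * (((2 : ℕ) : ℝ) - 1) ≤ groundEnergyAt G 1 U 2 := by
          push_cast; linarith
        nlinarith
    · have h := sector_lower_bound G hA hhA (fun k h => (hb_iff k).1 h) hγ0.le hγ' hU.le hφ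
      have hN' : (3 : ℝ) ≤ N := by exact_mod_cast hN
      have h1 : δ * ((N : ℝ) - 1) ≤ γ * ((N : ℝ) - 2) := by
        calc δ * ((N : ℝ) - 1) ≤ (γ / 2) * ((N : ℝ) - 1) :=
              mul_le_mul_of_nonneg_right hδγ (by linarith)
          _ ≤ (γ / 2) * (2 * ((N : ℝ) - 2)) :=
              mul_le_mul_of_nonneg_left (by linarith) (by linarith)
          _ = γ * ((N : ℝ) - 2) := by ring
      have hle : m N ≤ (N : ℝ) * E₁ + γ * ((N : ℝ) - 2) := by
        simp only [hm]; linarith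
      nlinarith
  -- the shifted Hamiltonian `H' = H + diag(-m(|s|))` is a nonnegative form
  set F : Matrix (Finset (Orb Λ)) (Finset (Orb Λ)) ℂ :=
    diagonal fun s : Finset (Orb Λ) => ((-m s.card : ℝ) : ℂ) with hF
  have hHsec := hamiltonian_apply_eq_zero_of_card_ne G 1 U
  have hGI := re_rayleigh_add_diagonal_nonneg H hHsec m hsec
  have hHherm : H.IsHermitian := LiebThm1.hamiltonian_isHermitian G 1 U
  have hGI' : ∀ x, 0 ≤ (star x ⬝ᵥ ((H + F) *ᵥ x)).re := fun x => by
    have h := hGI x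
    rwa [← hF] at h
  have hFherm : F.IsHermitian := by
    rw [hF]
    refine (Matrix.isHermitian_diagonal_iff).2 fun s => ?_
    show star _ = _
    exact Complex.conj_ofReal _
  have hH'herm : (H + F).IsHermitian := hHherm.add hFherm
  have hPSD : (H + F).PosSemidef := by
    refine Matrix.PosSemidef.of_dotProduct_mulVec_nonneg hH'herm fun x => ?_
    have h2 := hH'herm.im_star_dotProduct_mulVec_self x
    simp only [RCLike.im_to_complex] at h2
    exact Complex.nonneg_iff.2 ⟨hGI' x, h2.symm⟩
  have hcommHF : Commute H F := commute_hamiltonian_diagonal_card G 1 U fun N => ((-m N : ℝ) : ℂ)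
  -- diagonal Gibbs entries: `Re (e^{-βH})_{ss} ≤ e^{-β m(|s|)}` for `β ≥ 0`
  have hdiag : ∀ β : ℝ, 0 ≤ β → ∀ s : Finset (Orb Λ),
      ((Matrix.gibbsWeight β H) s s).re ≤ Real.exp (-(β * m s.card)) := by
    intro β hβ s
    have hsplit : -(β : ℂ) • H = -(β : ℂ) • (H + F) + (β : ℂ) • F := by
      simp only [smul_add, neg_smul]; abel
    have hc : Commute (-(β : ℂ) • (H + F)) ((β : ℂ) • F) :=
      (((hcommHF.add_left (Commute.refl F))).smul_left _).smul_right _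
    have hexpF : exp ((β : ℂ) • F) = diagonal fun s : Finset (Orb Λ) =>
        Complex.exp ((β : ℂ) * ((-m s.card : ℝ) : ℂ)) := by
      rw [hF, ← diagonal_smul, Matrix.exp_diagonal]
      congr 1
      funext s
      rw [Pi.coe_exp, Complex.exp_eq_exp_ℂ]
      rfl
    have hentry : (Matrix.gibbsWeight β H) s s =
        (Matrix.gibbsWeight β (H + F)) s s * Complex.exp ((β : ℂ) * ((-m s.card : ℝ) : ℂ)) := by
      rw [Matrix.gibbsWeight, hsplit, Matrix.exp_add_of_commute _ _ hc, hexpF, mul_diagonal,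
        ← Matrix.gibbsWeight]
    have hexp_real : Complex.exp ((β : ℂ) * ((-m s.card : ℝ) : ℂ)) =
        ((Real.exp (-(β * m s.card)) : ℝ) : ℂ) := by
      rw [← Complex.ofReal_mul, ← Complex.ofReal_exp]
      congr 1; ring
    rw [hentry, hexp_real, Complex.re_mul_ofReal]
    have h1 := re_gibbsWeight_apply_self_le_one hPSD hβ s
    have h2 := Real.exp_pos (-(β * m s.card))
    nlinarith
  -- the bottom one-particle state
  set f : Orb Λ → ℂ := fun o => if (ofLex o).2 = 0 then
      (hA.eigenvectorUnitary : Matrix Λ Λ ℂ) (ofLex o).1 b else 0 with hf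
  obtain ⟨hv1, hvnorm, hHv⟩ := bottomMode_eigenvector G hA hhA hbE U f (fun o => rfl)
  have hlow : ∀ β : ℝ, Real.exp (-(β * E₁)) ≤
      ∑ s ∈ Finset.univ.filter (fun s : Finset (Orb Λ) => s.card = 1),
        ((Matrix.gibbsWeight β H) s s).re := by
    intro β
    have hW : (Matrix.gibbsWeight β H).PosSemidef := (posDef_gibbsWeight β hHherm).posSemidef
    have hev : Matrix.gibbsWeight β H *ᵥ (create f *ᵥ vacuum) =
        Complex.exp (-(β : ℂ) * E₁) • (create f *ᵥ vacuum) := by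
      rw [Matrix.gibbsWeight]
      refine exp_mulVec_of_mulVec_eq_smul ?_
      rw [smul_mulVec, hHdef, hHv, smul_smul]
    have h := re_rayleigh_le_sum_re_diag hW (Finset.univ.filter fun s : Finset (Orb Λ) => s.card = 1)
      (v := create f *ᵥ vacuum) (fun s hs => hv1 s fun h => hs (by simp [h])) hvnorm
    rw [hev, dotProduct_smul, hvnorm, smul_eq_mul, mul_one, show -(β : ℂ) * E₁ = ((-(β * E₁) : ℝ) : ℂ)
      by push_cast; ring, ← Complex.ofReal_exp, Complex.ofReal_re] at h
    exact h
  -- choice of `β₁` and `μ`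
  set C : ℝ := (Fintype.card (Finset (Orb Λ)) : ℝ) with hC
  have hC1 : 1 ≤ C := by
    rw [hC]; exact_mod_cast Fintype.card_pos
  refine ⟨2 / δ * Real.log (C + 1), fun β hβ => ⟨E₁ + δ / 2, ?_⟩⟩
  have hlogpos : 0 < Real.log (C + 1) := Real.log_pos (by linarith)
  have hβ0 : 0 ≤ β := le_trans (by positivity) hβ
  have hβδ : Real.log (C + 1) ≤ β * δ / 2 := by
    have h := mul_le_mul_of_nonneg_right hβ (by positivity : (0 : ℝ) ≤ δ / 2)
    have h' : 2 / δ * Real.log (C + 1) * (δ / 2) = Real.log (C + 1) := by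
      field_simp
    calc Real.log (C + 1) = 2 / δ * Real.log (C + 1) * (δ / 2) := h'.symm
      _ ≤ β * (δ / 2) := h
      _ = β * δ / 2 := by ring
  have hbig : C + 1 ≤ Real.exp (β * δ / 2) := by
    calc C + 1 = Real.exp (Real.log (C + 1)) := (Real.exp_log (by linarith)).symm
      _ ≤ Real.exp (β * δ / 2) := Real.exp_le_exp.2 hβδ
  -- the sector sum
  rw [parity_trace_eq_sum G U (E₁ + δ / 2) β, Complex.re_sum]
  set g : Finset (Orb Λ) → ℝ := fun s => ((-1 : ℂ) ^ s.card *
    (Complex.exp ((β * (E₁ + δ / 2) * s.card : ℝ) : ℂ) * (Matrix.gibbsWeight β H) s s)).re with hg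
  have hgre : ∀ s : Finset (Orb Λ), g s = (-1 : ℝ) ^ s.card *
      (Real.exp (β * (E₁ + δ / 2) * s.card) * ((Matrix.gibbsWeight β H) s s).re) := by
    intro s
    rw [hg]
    simp only
    rw [← Complex.ofReal_exp, show ((-1 : ℂ)) ^ s.card = (((-1 : ℝ) ^ s.card : ℝ) : ℂ) by push_cast; ring,
      Complex.re_ofReal_mul, Complex.re_ofReal_mul]
  have hWnn : ∀ s : Finset (Orb Λ), 0 ≤ ((Matrix.gibbsWeight β H) s s).re := fun s => by
    have := ((posDef_gibbsWeight β hHherm).posSemidef).diag_nonneg (i := s)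
    exact (Complex.nonneg_iff.1 this).1
  -- every configuration with `|s| ≠ 1` contributes at most `1`
  have hother : ∀ s : Finset (Orb Λ), s.card ≠ 1 → g s ≤ 1 := by
    intro s hs1
    rw [hgre]
    by_cases hs0 : s.card = 0
    · rw [Finset.card_eq_zero.1 hs0, Finset.card_empty, pow_zero, one_mul, Nat.cast_zero, mul_zero,
        Real.exp_zero, one_mul, hHdef, gibbsWeight_apply_empty_empty, Complex.one_re]
    · have hs2 : (2 : ℝ) ≤ s.card := by exact_mod_cast (show 2 ≤ s.card by omega)
      have hd := hdiag β hβ0 s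
      have hWs := hWnn s
      have hexp1 : Real.exp (β * (E₁ + δ / 2) * s.card) * Real.exp (-(β * m s.card)) ≤ 1 := by
        rw [← Real.exp_add, Real.exp_le_one_iff, hm]
        simp only
        nlinarith [mul_nonneg hβ0 hδ0.le]
      have habs : |(-1 : ℝ) ^ s.card| = 1 := by rw [abs_pow, abs_neg, abs_one, one_pow]
      calc (-1 : ℝ) ^ s.card * (Real.exp (β * (E₁ + δ / 2) * s.card) * ((Matrix.gibbsWeight β H) s s).re)
          ≤ |(-1 : ℝ) ^ s.card * (Real.exp (β * (E₁ + δ / 2) * s.card) *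
              ((Matrix.gibbsWeight β H) s s).re)| := le_abs_self _
        _ = Real.exp (β * (E₁ + δ / 2) * s.card) * ((Matrix.gibbsWeight β H) s s).re := by
            rw [abs_mul, habs, one_mul, abs_of_nonneg (mul_nonneg (Real.exp_pos _).le hWs)]
        _ ≤ Real.exp (β * (E₁ + δ / 2) * s.card) * Real.exp (-(β * m s.card)) := by gcongr
        _ ≤ 1 := hexp1
  -- the one-particle sector contributes at most `-e^{βδ/2}`
  have hone : ∑ s ∈ Finset.univ.filter (fun s : Finset (Orb Λ) => s.card = 1), g s ≤
      -Real.exp (β * δ / 2) := by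
    have heq : ∀ s ∈ Finset.univ.filter (fun s : Finset (Orb Λ) => s.card = 1),
        g s = -(Real.exp (β * (E₁ + δ / 2)) * ((Matrix.gibbsWeight β H) s s).re) := by
      intro s hs
      rw [Finset.mem_filter] at hs
      rw [hgre, hs.2, pow_one, Nat.cast_one, mul_one, neg_one_mul]
    rw [Finset.sum_congr rfl heq, Finset.sum_neg_distrib, ← Finset.mul_sum, neg_le_neg_iff]
    calc Real.exp (β * δ / 2) = Real.exp (β * (E₁ + δ / 2)) * Real.exp (-(β * E₁)) := by
          rw [← Real.exp_add]; congr 1; ring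
      _ ≤ Real.exp (β * (E₁ + δ / 2)) * ∑ s ∈ Finset.univ.filter
            (fun s : Finset (Orb Λ) => s.card = 1), ((Matrix.gibbsWeight β H) s s).re := by
          gcongr; exact hlow β
  -- conclusion
  have hsplitsum : ∑ s, g s = ∑ s ∈ Finset.univ.filter (fun s : Finset (Orb Λ) => s.card = 1), g s +
      ∑ s ∈ Finset.univ.filter (fun s : Finset (Orb Λ) => ¬ s.card = 1), g s :=
    (Finset.sum_filter_add_sum_filter_not _ _ _).symm
  have hrest : ∑ s ∈ Finset.univ.filter (fun s : Finset (Orb Λ) => ¬ s.card = 1), g s ≤ C := by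
    calc ∑ s ∈ Finset.univ.filter (fun s : Finset (Orb Λ) => ¬ s.card = 1), g s
        ≤ ∑ _s ∈ Finset.univ.filter (fun s : Finset (Orb Λ) => ¬ s.card = 1), (1 : ℝ) :=
          Finset.sum_le_sum fun s hs => hother s (Finset.mem_filter.1 hs).2
      _ = ((Finset.univ.filter (fun s : Finset (Orb Λ) => ¬ s.card = 1)).card : ℝ) := by
          rw [Finset.sum_const, nsmul_eq_mul, mul_one]
      _ ≤ C := by
          rw [hC]; exact_mod_cast Finset.card_le_univ _
  show ∑ s, g s < 0
  rw [hsplitsum]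
  linarith

end Connected

section Torus

open Literature.Probability.LatticeModels

/-- The fermionic torus `(ℤ/Lℤ)^d`, `L ≠ 0`, is connected (projected lattice paths). [folklore] -/
theorem fermionTorus_reflTransGen {d L : ℕ} [NeZero L] (x y : FermionTorus d L) :
    Relation.ReflTransGen (fermionTorusGraph d L).Adj x y := by
  have hp : ∀ z : FermionTorus d L,
      Torus.proj L (fun i => ((FermionTorus.toTorusSite z i).val : ℤ)) = FermionTorus.toTorusSite z := by
    intro z; funext i; simp [Torus.proj]
  have h := torusGraph_reachable_proj (d := d) L
    (fun i => ((FermionTorus.toTorusSite x i).val : ℤ)) (fun i => ((FermionTorus.toTorusSite y i).val : ℤ))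
  rw [hp, hp, SimpleGraph.reachable_iff_reflTransGen] at h
  have hstep : ∀ a b : TorusSite d L, (torusGraph d L).Adj a b →
      (fermionTorusGraph d L).Adj (FermionTorus.ofTorusSite a) (FermionTorus.ofTorusSite b) := by
    intro a b hab
    rw [fermionTorusGraph_adj, FermionTorus.toTorusSite_ofTorusSite,
      FermionTorus.toTorusSite_ofTorusSite]
    exact hab
  have h2 := Relation.ReflTransGen.lift (p := (fermionTorusGraph d L).Adj)
    FermionTorus.ofTorusSite hstep _ _ h
  simp only [Function.onFun] at h2
  rwa [FermionTorus.ofTorusSite_toTorusSite, FermionTorus.ofTorusSite_toTorusSite] at h2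

end Torus

end Literature.MathematicalPhysics.QuantumLattice.HubbardBandBottom
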